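import Summits.BirchSwinnertonDyer.BirchSwinnertonDyer.Theorems.KimAtThreeFineKatoKPortJunctionAnomalous
import Summits.BirchSwinnertonDyer.BirchSwinnertonDyer.Theorems.KimAtThreeFineKatoKPortJunction
import Summits.BirchSwinnertonDyer.BirchSwinnertonDyer.Theorems.KimAtThreeSemiLocalTraceDualTwistLocal
import HarnessLib

/-!
# Kato's `σ_u` (`u ≡ p mod m`) IS the arithmetic Frobenius at every place of `ℚ(ζ_m)` above `p ∤ m` —
# and the good-anomalous lattice lemma in the `sigma` currency of item 20397

Cell `bsd-addord`, seat `bsd-addord-w2-acc3` (PROGRAMME PART 1b row (3), gen 8); `--supports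
stmt-BirchSwinnertonDyer-19679` (helper). TOOL theorems only (no definition, no instance, no named fact, no
`sorry`); closes nothing by itself; nothing booked; BSD / 19679 / 19599 / 20397 are not proved by any of this.

WHY. The E-side LATTICE LEMMA of the good-ANOMALOUS `t = 0` rows (items 19679 / 19599, support item 20397
`FineKatoTauAnomalousThree`) is in the tree with ROW hypotheses only (w2-kport gen 8,
`KPort.Kw.exists_padicLog_eq_iff_of_frobenius_of_natCard_eq_one`, p533589): besides the row data it takes a
place `w ∣ p` with `e(w∣p) = 1` and a GLOBAL Frobenius `σ ∈ Aut(L/ℚ)` with `σ • w = w` and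
`σ • a ≡ a^p (mod 𝔭_w)`, plus `φ = σ_w` on `K_w`. Item 20397 is typed at the TAME cyclotomic levels
`L = ℚ(ζ_m) = CyclotomicField m ℚ`, `3 ∤ m`, with Kato's automorphisms `σ_g = EulerSystemValues.sigma m g`
(`ζ ↦ ζ^g`), the Euler factor being `P_w = p − a·σ_w + σ_w²` with `w·[p] = 1`, i.e. `σ_w = σ_{[p]}⁻¹`. This file
supplies the Frobenius data for THAT `σ`: for `p ∤ m`, `u ≡ p (mod m)` and EVERY `𝔓 ∣ p` of `ℚ(ζ_m)`,

* §1 ★ `isArithFrobAt_sigma` — `IsArithFrobAt ℤ (sigma m u) 𝔓` (Mathlib's arithmetic Frobenius EXISTS at `𝔓`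
  (`IsArithFrobAt.exists_of_isInvariant`), raises `ζ_m ↦ ζ_m^p` (`apply_of_pow_eq_one`, `m ∉ 𝔓`), hence equals
  `σ_u` — the argument of gen 6's `sigma_smul_eq_self_of_coe_eq`, now exported as a statement);
  `sigma_smul_sub_pow_mem` (`σ_u • a − a^p ∈ 𝔓`, the `hσp` binder); `natCast_level_not_mem` (`m ∉ 𝔓`).
* §2 `orderOf_sigma_eq_orderOf` (`ord σ_u = ord u`), ★ `orderOf_sigma_eq_inertiaDeg` (`ord σ_u = f(𝔓∣p)`, kport
  `Kw.orderOf_eq_inertiaDeg_of_frobenius` with `e(𝔓∣p) = 1` from `Kw.ramificationIdx_eq_one_of_isCyclotomicExtension`),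
  `inertiaDeg_eq_orderOf_natCast` (`f(𝔓∣p) = ord_m p`, Washington Thm. 2.13, here via §1 rather than Mathlib's
  Kummer–Dedekind route), `galAdicCompletionMap_sigma_inv_apply` (`(σ_w)_𝔓 ∘ (σ_u)_𝔓 = id` for `w·u = 1`:
  the local operator `S = (σ_w)_𝔓` of gen 6's `padicTensor_eulerTwist_apply` is `φ⁻¹`),
  `exists_frobenius_sigma` (a `ℚ_p`-algebra map `φ` of `K_𝔓` agreeing with `(σ_u)_𝔓`: isometry, lift of `x ↦ x^p`,
  `φ^{f} = 1`, lower powers distinct).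
* §3 the END FORMS on a good-anomalous row, every binder an item-level hypothesis of 20397 / 19599 / 19679:
  ★★ `forall_prime_nsmul_eq_zero_cyclotomic_of_natCard_eq_one` (`E(ℚ(ζ_m)_𝔓)[p] = 0` from
  `#E(ℚ_p)[p] = 1`, `p ≥ 3`, `p ∤ Δ_min`, `p ∣ a_p − 1`, `p ∤ m`) and ★★
  `exists_padicLog_eq_iff_sigma_of_natCard_eq_one`: for `φ = (σ_u)_𝔓` on `K_𝔓`,
  `(∃ P ∈ E(L_𝔓), log_ω P = y) ↔ ‖φφy − a_p·φy + p·y‖ ≤ ‖p‖` — no `Fact`, no `σ`-binder, no local hypothesis left.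

References: L. C. Washington, *Introduction to Cyclotomic Fields* (1997) Lemma 2.12, Thm. 2.13 [Washington1997];
J. W. S. Cassels, A. Fröhlich (eds.), *Algebraic Number Theory* (1967) Ch. VII §1.1, §2.1 [CasselsFrohlichANT1967];
S. Bloch, K. Kato (1990) Example 3.11 [BlochKato1990]; J. H. Silverman, *AEC* (2009) VII.3.1, IV.6.1, IV.6.4
[SilvermanAEC2009]; K. Kato, *Astérisque* 295 (2004) (5.7.1) [Kato2004Asterisque].
-/

set_option autoImplicit false
-- the cell's Theorems namespace `Summit.BirchSwinnertonDyer.BirchSwinnertonDyer.…` repeats the summit name by design (D-0017)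
set_option linter.dupNamespace false
-- `CyclotomicField m ℚ`'s two `ℚ`-algebra structures agree only up to unfolding (as in the sibling files)
set_option backward.isDefEq.respectTransparency false

noncomputable section

open scoped Classical NNReal NumberField
open IsDedekindDomain NumberField
open Literature.NumberTheory.Automorphic Literature.NumberTheory.AdelicBaseChange
open Literature.NumberTheory.EllipticCurves.Kato2004.EulerSystemValues (sigma sigma_apply_zeta)
open Summit.BirchSwinnertonDyer.BirchSwinnertonDyer.Theorems.KPort
open Summit.BirchSwinnertonDyer.BirchSwinnertonDyer.Theorems.KimAtThreeKwFrobenius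
open Summit.BirchSwinnertonDyer.BirchSwinnertonDyer.Theorems.KimAtThreeSemiLocalTraceDualTwistLocal

namespace Summit.BirchSwinnertonDyer.BirchSwinnertonDyer.Theorems.KimAtThreeCyclotomicSigmaFrobenius

variable (m : ℕ) [NeZero m] (p : ℕ) [hp : Fact p.Prime]

/-! ## §1 `σ_u` is an arithmetic Frobenius at every `𝔓 ∣ p` -/

omit [NeZero m] in
/-- `m ∉ 𝔓` for a place `𝔓 ∣ p` of `ℚ(ζ_m)` when `p ∤ m` (`𝔓 ∩ ℤ = (p)`). [folklore] -/
theorem natCast_level_not_mem (hpm : ¬ p ∣ m)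
    (w : ((Rat.HeightOneSpectrum.primesEquiv (R := 𝓞 ℚ)).symm ⟨p, hp.out⟩).Extension
      (𝓞 (CyclotomicField m ℚ))) :
    ((m : ℕ) : 𝓞 (CyclotomicField m ℚ)) ∉ w.1.asIdeal := by
  intro hmem
  have h1 : (m : ℤ) ∈ w.1.asIdeal.under ℤ := by
    rw [Ideal.under_def, Ideal.mem_comap, map_natCast]; exact hmem
  rw [under_int_eq (w := w), Ideal.mem_span_singleton] at h1
  exact hpm (by exact_mod_cast h1)

/-- ★ **Kato's `σ_u` (`u ≡ p mod m`, `ζ ↦ ζ^p`) is Mathlib's arithmetic Frobenius at EVERY place `𝔓 ∣ p` of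
`ℚ(ζ_m)`, `p ∤ m`**: `σ_u • a ≡ a^{#(ℤ/𝔓∩ℤ)} (mod 𝔓)` on `𝓞_{ℚ(ζ_m)}`.  Proof: an arithmetic Frobenius `σ` at `𝔓`
exists in `Gal(ℚ(ζ_m)/ℚ)` (Mathlib `IsArithFrobAt.exists_of_isInvariant`, `(𝓞)^{Gal} = ℤ`); it sends
`ζ_m ↦ ζ_m^p` (`apply_of_pow_eq_one`, as `m ∉ 𝔓`), and an automorphism of `ℚ(ζ_m)` is determined by `ζ_m`, so
`σ = σ_u`. [cite: Washington1997, Lemma 2.12 and Thm. 2.13] -/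
theorem isArithFrobAt_sigma (hpm : ¬ p ∣ m) (u : (ZMod m)ˣ) (hu : (u : ZMod m) = (p : ZMod m))
    (w : ((Rat.HeightOneSpectrum.primesEquiv (R := 𝓞 ℚ)).symm ⟨p, hp.out⟩).Extension
      (𝓞 (CyclotomicField m ℚ))) :
    IsArithFrobAt ℤ (sigma m u) w.1.asIdeal := by
  haveI := isInvariant_int_ringOfIntegers m
  haveI : Finite (𝓞 (CyclotomicField m ℚ) ⧸ w.1.asIdeal) :=
    Ideal.finiteQuotientOfFreeOfNeBot _ w.1.ne_bot
  obtain ⟨σ, hσ⟩ := IsArithFrobAt.exists_of_isInvariant ℤ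
    (CyclotomicField m ℚ ≃ₐ[ℚ] CyclotomicField m ℚ) w.1.asIdeal
  -- `σ ζ = ζ^p`
  have hζ := IsCyclotomicExtension.zeta_spec m ℚ (CyclotomicField m ℚ)
  have hm0 : 0 < m := Nat.pos_of_ne_zero (NeZero.ne m)
  set ζ : 𝓞 (CyclotomicField m ℚ) :=
    ⟨IsCyclotomicExtension.zeta m ℚ (CyclotomicField m ℚ), hζ.isIntegral hm0⟩ with hζdef
  have hζm : ζ ^ m = 1 := by
    apply RingOfIntegers.ext
    simp [hζdef, hζ.pow_eq_one]
  have hmQ : ((m : ℕ) : 𝓞 (CyclotomicField m ℚ)) ∉ w.1.asIdeal := natCast_level_not_mem m p hpm w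
  have hσζ : (σ : CyclotomicField m ℚ ≃ₐ[ℚ] CyclotomicField m ℚ)
      (IsCyclotomicExtension.zeta m ℚ (CyclotomicField m ℚ)) =
      IsCyclotomicExtension.zeta m ℚ (CyclotomicField m ℚ) ^ p := by
    have h := AlgHom.IsArithFrobAt.apply_of_pow_eq_one hσ hζm hmQ
    rw [natCard_int_quot_under_eq m p w, MulSemiringAction.toAlgHom_apply] at h
    have h' := congrArg (fun y : 𝓞 (CyclotomicField m ℚ) => (y : CyclotomicField m ℚ)) h
    simpa [hζdef, RingOfIntegers.coe_algEquiv_smul] using h'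
  -- hence `σ = σ_u`
  have hσu : σ = sigma m u := by
    apply AlgEquiv.coe_toAlgHom_injective
    refine (hζ.powerBasis ℚ).algHom_ext ?_
    rw [IsPrimitiveRoot.powerBasis_gen, AlgEquiv.coe_toAlgHom, AlgEquiv.coe_toAlgHom, hσζ,
      sigma_apply_zeta, hu, ZMod.val_natCast]
    conv_lhs => rw [← Nat.mod_add_div p m, pow_add, pow_mul, hζ.pow_eq_one, one_pow, mul_one]
  rw [← hσu]
  exact hσ

/-- **`σ_u • a ≡ a^p (mod 𝔓)` on `𝓞_{ℚ(ζ_m)}`** for `u ≡ p (mod m)`, `p ∤ m`, every `𝔓 ∣ p` — the `hσp` binder of the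
lattice lemma (`KPort.Kw.exists_padicLog_eq_iff_of_frobenius_of_natCard_eq_one`) for Kato's `σ_u`.
[cite: CasselsFrohlichANT1967, Ch. VII §2.1] -/
theorem sigma_smul_sub_pow_mem (hpm : ¬ p ∣ m) (u : (ZMod m)ˣ) (hu : (u : ZMod m) = (p : ZMod m))
    (w : ((Rat.HeightOneSpectrum.primesEquiv (R := 𝓞 ℚ)).symm ⟨p, hp.out⟩).Extension
      (𝓞 (CyclotomicField m ℚ)))
    (a : 𝓞 (CyclotomicField m ℚ)) : sigma m u • a - a ^ p ∈ w.1.asIdeal :=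
  smul_sub_pow_mem_of_isArithFrobAt (sigma m u) (isArithFrobAt_sigma m p hpm u hu w) a

/-! ## §2 Order, residue degree, the inverse, and the transported `φ = (σ_u)_𝔓` -/

omit hp in
/-- `ord σ_u = ord u` (`σ : (ℤ/m)ˣ ≅ Gal(ℚ(ζ_m)/ℚ)` is a group isomorphism). [folklore] -/
theorem orderOf_sigma_eq_orderOf (u : (ZMod m)ˣ) : orderOf (sigma m u) = orderOf u := by
  unfold sigma
  exact MulEquiv.orderOf_eq _ u

/-- ★ **`ord σ_u = f(𝔓∣p)`** for `u ≡ p (mod m)`, `p ∤ m`, every `𝔓 ∣ p` of `ℚ(ζ_m)` — the `hord` binder, by kport's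
`Kw.orderOf_eq_inertiaDeg_of_frobenius` (a Frobenius element at an unramified place has order the residue
degree; `e(𝔓∣p) = 1` by `Kw.ramificationIdx_eq_one_of_isCyclotomicExtension`).
[cite: Washington1997, Thm. 2.13] -/
theorem orderOf_sigma_eq_inertiaDeg (hpm : ¬ p ∣ m) (u : (ZMod m)ˣ) (hu : (u : ZMod m) = (p : ZMod m))
    (w : ((Rat.HeightOneSpectrum.primesEquiv (R := 𝓞 ℚ)).symm ⟨p, hp.out⟩).Extension
      (𝓞 (CyclotomicField m ℚ))) :
    orderOf (sigma m u) = w.1.asIdeal.inertiaDeg (𝓞 ℚ) := by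
  haveI : Fact (w.1.asIdeal.ramificationIdx (𝓞 ℚ) = 1) :=
    ⟨Kw.ramificationIdx_eq_one_of_isCyclotomicExtension m hpm⟩
  exact Kw.orderOf_eq_inertiaDeg_of_frobenius (sigma m u) (sigma_smul_eq_self_of_coe_eq m p hpm u hu w)
    (sigma_smul_sub_pow_mem m p hpm u hu w)

/-- **`f(𝔓∣p) = ord_m p`** for every place `𝔓 ∣ p` of `ℚ(ζ_m)`, `p ∤ m` (Washington Thm. 2.13; here from §1–§2:
`f = ord σ_u = ord u = ord (p mod m)`). [cite: Washington1997, Thm. 2.13] -/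
theorem inertiaDeg_eq_orderOf_natCast (hpm : ¬ p ∣ m)
    (w : ((Rat.HeightOneSpectrum.primesEquiv (R := 𝓞 ℚ)).symm ⟨p, hp.out⟩).Extension
      (𝓞 (CyclotomicField m ℚ))) :
    w.1.asIdeal.inertiaDeg (𝓞 ℚ) = orderOf ((p : ℕ) : ZMod m) := by
  have hcop : p.Coprime m := (Nat.Prime.coprime_iff_not_dvd hp.out).mpr hpm
  have hu : ((ZMod.unitOfCoprime p hcop : (ZMod m)ˣ) : ZMod m) = (p : ZMod m) := ZMod.coe_unitOfCoprime p hcop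
  rw [← orderOf_sigma_eq_inertiaDeg m p hpm _ hu, orderOf_sigma_eq_orderOf, ← orderOf_units, hu]

/-- **`(σ_{w})_𝔓 ∘ (σ_u)_𝔓 = id` on `ℚ(ζ_m)_𝔓` for `w·u = 1`**: the local operator `S = (σ_w)_𝔓` of the Euler
twist `P_w` (gen 6 `padicTensor_eulerTwist_apply`, `w·[p] = 1`) is the INVERSE of the Frobenius `φ = (σ_u)_𝔓`.
[cite: CasselsFrohlichANT1967, Ch. VII §1.1] -/
theorem galAdicCompletionMap_sigma_inv_apply (hpm : ¬ p ∣ m) (u w' : (ZMod m)ˣ)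
    (hu : (u : ZMod m) = (p : ZMod m)) (hw' : (w' : ZMod m) * ((p : ℕ) : ZMod m) = 1)
    (w : ((Rat.HeightOneSpectrum.primesEquiv (R := 𝓞 ℚ)).symm ⟨p, hp.out⟩).Extension
      (𝓞 (CyclotomicField m ℚ)))
    (y : w.1.adicCompletion (CyclotomicField m ℚ)) :
    galAdicCompletionMap (sigma m w') (sigma_smul_eq_self_of_mul_coe_eq_one m p hpm w' hw' w)
      (galAdicCompletionMap (sigma m u) (sigma_smul_eq_self_of_coe_eq m p hpm u hu w) y) = y := by
  have hwu : w' = u⁻¹ := by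
    rw [← hu] at hw'
    exact eq_inv_of_mul_eq_one_left (Units.ext (by simpa using hw'))
  have hσ : sigma m w' = (sigma m u)⁻¹ := by
    rw [hwu]; unfold sigma; rw [map_inv]
  rw [galAdicCompletionMap_congr_left (CyclotomicField m ℚ) hσ _
    (inv_smul_eq_iff.mpr (sigma_smul_eq_self_of_coe_eq m p hpm u hu w).symm),
    galAdicCompletionMap_inv_apply]

/-- **The transported Frobenius `φ = (σ_u)_𝔓` on `K_𝔓` (package)**: for `p ∤ m`, `u ≡ p (mod m)` and `𝔓 ∣ p`
there is a `ℚ_p`-algebra endomorphism `φ` of `K_𝔓 = KPort.Kw p ℚ(ζ_m) 𝔓` agreeing with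
`galAdicCompletionMap (sigma m u)`, which is an isometry, lifts `x ↦ x^p` on the unit ball, satisfies
`φ^{f(𝔓∣p)} = 1` pointwise and has `φ⁰, …, φ^{f−1}` pairwise distinct (gen 7 `exists_frobenius` + §1–§2).
[cite: CasselsFrohlichANT1967, Ch. VII §1.1 and §2.1] -/
theorem exists_frobenius_sigma (hpm : ¬ p ∣ m) (u : (ZMod m)ˣ) (hu : (u : ZMod m) = (p : ZMod m))
    (w : ((Rat.HeightOneSpectrum.primesEquiv (R := 𝓞 ℚ)).symm ⟨p, hp.out⟩).Extension
      (𝓞 (CyclotomicField m ℚ))) :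
    ∃ φ : Kw p (CyclotomicField m ℚ) w →ₐ[ℚ_[p]] Kw p (CyclotomicField m ℚ) w,
      (∀ y, Kw.toCompletion p (CyclotomicField m ℚ) w (φ y) =
        galAdicCompletionMap (sigma m u) (sigma_smul_eq_self_of_coe_eq m p hpm u hu w)
          (Kw.toCompletion p (CyclotomicField m ℚ) w y)) ∧
      (∀ y, ‖φ y‖ = ‖y‖) ∧ (∀ y, ‖y‖ ≤ 1 → ‖φ y - y ^ p‖ < 1) ∧
      (∀ y, (φ ^ w.1.asIdeal.inertiaDeg (𝓞 ℚ)) y = y) ∧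
      ∀ i j : ℕ, i < w.1.asIdeal.inertiaDeg (𝓞 ℚ) → j < w.1.asIdeal.inertiaDeg (𝓞 ℚ) →
        (⇑(φ ^ i) : Kw p (CyclotomicField m ℚ) w → Kw p (CyclotomicField m ℚ) w) = ⇑(φ ^ j) → i = j := by
  rw [← orderOf_sigma_eq_inertiaDeg m p hpm u hu w]
  exact exists_frobenius (sigma m u) (sigma_smul_eq_self_of_coe_eq m p hpm u hu w)
    (sigma_smul_sub_pow_mem m p hpm u hu w)

/-! ## §3 The good-anomalous lattice lemma in the `sigma` currency — item-level binders only -/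

variable (W : WeierstrassCurve ℚ) [W.IsElliptic] [W.IsGloballyMinimal]

/-- ★★ **`E(ℚ(ζ_m)_𝔓)[p] = 0` on a good-ANOMALOUS row**, every binder item-level: `p ∤ m`, `𝔓 ∣ p`, `p ≥ 3`,
`W/ℚ` globally minimal with `p ∤ Δ_min(W)`, `a_p ≡ 1 (mod p)`, and `#E(ℚ_p)[p] = 1` in the items' spelling
(kport `Kw.forall_prime_nsmul_eq_zero_of_frobenius_anomalous'` at `σ := σ_u`, `e(𝔓∣p) = 1` discharged).
[cite: SilvermanAEC2009, VII.3 Prop. 3.1, IV.6 Thm. 6.1 and V.2.3.1] -/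
theorem forall_prime_nsmul_eq_zero_cyclotomic_of_natCard_eq_one (hpm : ¬ p ∣ m)
    (w : ((Rat.HeightOneSpectrum.primesEquiv (R := 𝓞 ℚ)).symm ⟨p, hp.out⟩).Extension
      (𝓞 (CyclotomicField m ℚ)))
    (hp3 : 3 ≤ p) (hΔ : ¬ (p : ℤ) ∣ WeierstrassCurve.minimalDiscriminantInt W)
    (hap : (p : ℤ) ∣ W.frobeniusTrace p - 1)
    (ht : Nat.card {Q : (W.baseChange ℚ_[p]).toAffine.Point // (p : ℕ) • Q = 0} = 1)
    (P : (W.baseChange (w.1.adicCompletion (CyclotomicField m ℚ))).toAffine.Point) (hP : p • P = 0) :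
    P = 0 := by
  haveI : Fact (w.1.asIdeal.ramificationIdx (𝓞 ℚ) = 1) :=
    ⟨Kw.ramificationIdx_eq_one_of_isCyclotomicExtension m hpm⟩
  have hcop : p.Coprime m := (Nat.Prime.coprime_iff_not_dvd hp.out).mpr hpm
  have hu : ((ZMod.unitOfCoprime p hcop : (ZMod m)ˣ) : ZMod m) = (p : ZMod m) := ZMod.coe_unitOfCoprime p hcop
  exact Kw.forall_prime_nsmul_eq_zero_of_frobenius_anomalous' W hp3 hΔ hap
    (Kw.forall_nsmul_eq_zero_of_natCard_eq_one (W.baseChange ℚ_[p]) ht) (sigma m _)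
    (sigma_smul_eq_self_of_coe_eq m p hpm _ hu w) (sigma_smul_sub_pow_mem m p hpm _ hu w) P hP

/-- ★★ **The lattice lemma `log_ω E(L_𝔓) = E_p(φ)⁻¹𝒪_𝔓` in item 20397's `sigma` currency — item-level binders
only.**  `L = ℚ(ζ_m)` with `p ∤ m`, `𝔓 ∣ p`, `u ≡ p (mod m)`, `φ` ANY `ℚ_p`-algebra map of `K_𝔓` agreeing with
`(σ_u)_𝔓 = galAdicCompletionMap (sigma m u)` (exists: `exists_frobenius_sigma`); `p ≥ 3`, `W/ℚ` globally minimal,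
`p ∤ Δ_min(W)`, `a_p ≡ 1 (mod p)`, `#E(ℚ_p)[p] = 1`.  Then for `y ∈ K_𝔓`:
`(∃ P ∈ E(L_𝔓), log_ω P = y) ↔ ‖φφy − a_p·φy + p·y‖ ≤ ‖p‖` (kport J7 at `σ := σ_u`, with `hσ`, `hσp`,
`e(𝔓∣p) = 1` supplied by §1 and `Kw.ramificationIdx_eq_one_of_isCyclotomicExtension`).
[cite: BlochKato1990, Example 3.11] [cite: SilvermanAEC2009, VII.3.1, IV.6.1, IV.6.4] -/
theorem exists_padicLog_eq_iff_sigma_of_natCard_eq_one (hpm : ¬ p ∣ m) (u : (ZMod m)ˣ)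
    (hu : (u : ZMod m) = (p : ZMod m))
    (w : ((Rat.HeightOneSpectrum.primesEquiv (R := 𝓞 ℚ)).symm ⟨p, hp.out⟩).Extension
      (𝓞 (CyclotomicField m ℚ)))
    (hp3 : 3 ≤ p) (hΔ : ¬ (p : ℤ) ∣ WeierstrassCurve.minimalDiscriminantInt W)
    (hap : (p : ℤ) ∣ W.frobeniusTrace p - 1)
    (ht : Nat.card {Q : (W.baseChange ℚ_[p]).toAffine.Point // (p : ℕ) • Q = 0} = 1)
    (φ : Kw p (CyclotomicField m ℚ) w →ₐ[ℚ_[p]] Kw p (CyclotomicField m ℚ) w)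
    (hφ : ∀ y, Kw.toCompletion p (CyclotomicField m ℚ) w (φ y) =
      galAdicCompletionMap (sigma m u) (sigma_smul_eq_self_of_coe_eq m p hpm u hu w)
        (Kw.toCompletion p (CyclotomicField m ℚ) w y))
    (y : Kw p (CyclotomicField m ℚ) w) :
    haveI := Literature.NumberTheory.EllipticCurves.EulerLattice.isIntegral_baseChange w.1 W
    (∃ P : (W.baseChange (w.1.adicCompletion (CyclotomicField m ℚ))).toAffine.Point,
      Literature.NumberTheory.EllipticCurves.FormalGroupChart.padicLogPointFiniteExt
        (NormedField.valuation : Valuation (w.1.adicCompletion (CyclotomicField m ℚ)) ℝ≥0)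
        (W.baseChange (w.1.adicCompletion (CyclotomicField m ℚ))) p P =
          Kw.toCompletion p (CyclotomicField m ℚ) w y) ↔
    ‖φ (φ y) - (W.frobeniusTrace p : Kw p (CyclotomicField m ℚ) w) * φ y
        + (p : Kw p (CyclotomicField m ℚ) w) * y‖ ≤ ‖(p : Kw p (CyclotomicField m ℚ) w)‖ := by
  haveI : Fact (w.1.asIdeal.ramificationIdx (𝓞 ℚ) = 1) :=
    ⟨Kw.ramificationIdx_eq_one_of_isCyclotomicExtension m hpm⟩
  exact Kw.exists_padicLog_eq_iff_of_frobenius_of_natCard_eq_one W hp3 hΔ hap ht (sigma m u)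
    (sigma_smul_eq_self_of_coe_eq m p hpm u hu w) (sigma_smul_sub_pow_mem m p hpm u hu w) φ hφ y

/-- **The same lattice lemma for ANY Frobenius lift `φ` of `K_𝔓`** (`hφp : ‖x‖ ≤ 1 → ‖φ x − x^p‖ < 1`; no `σ` at
all — e.g. `(σ_u)_𝔓`, or its conjugates), `L = ℚ(ζ_m)`, `p ∤ m`: kport's
`Kw.exists_padicLog_eq_iff_norm_eulerOperator_le_of_frobeniusLift_of_natCard_eq_one` with `e(𝔓∣p) = 1` discharged.
[cite: BlochKato1990, Example 3.11] [cite: SilvermanAEC2009, VII.3.1, IV.6.1, IV.6.4] -/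
theorem exists_padicLog_eq_iff_frobeniusLift_cyclotomic_of_natCard_eq_one (hpm : ¬ p ∣ m)
    (w : ((Rat.HeightOneSpectrum.primesEquiv (R := 𝓞 ℚ)).symm ⟨p, hp.out⟩).Extension
      (𝓞 (CyclotomicField m ℚ)))
    (hp3 : 3 ≤ p) (hΔ : ¬ (p : ℤ) ∣ WeierstrassCurve.minimalDiscriminantInt W)
    (hap : (p : ℤ) ∣ W.frobeniusTrace p - 1)
    (ht : Nat.card {Q : (W.baseChange ℚ_[p]).toAffine.Point // (p : ℕ) • Q = 0} = 1)
    (φ : Kw p (CyclotomicField m ℚ) w →ₐ[ℚ_[p]] Kw p (CyclotomicField m ℚ) w)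
    (hφp : ∀ x : Kw p (CyclotomicField m ℚ) w, ‖x‖ ≤ 1 → ‖φ x - x ^ p‖ < 1)
    (y : Kw p (CyclotomicField m ℚ) w) :
    haveI := Literature.NumberTheory.EllipticCurves.EulerLattice.isIntegral_baseChange w.1 W
    (∃ P : (W.baseChange (w.1.adicCompletion (CyclotomicField m ℚ))).toAffine.Point,
      Literature.NumberTheory.EllipticCurves.FormalGroupChart.padicLogPointFiniteExt
        (NormedField.valuation : Valuation (w.1.adicCompletion (CyclotomicField m ℚ)) ℝ≥0)
        (W.baseChange (w.1.adicCompletion (CyclotomicField m ℚ))) p P =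
          Kw.toCompletion p (CyclotomicField m ℚ) w y) ↔
    ‖φ (φ y) - (W.frobeniusTrace p : Kw p (CyclotomicField m ℚ) w) * φ y
        + (p : Kw p (CyclotomicField m ℚ) w) * y‖ ≤ ‖(p : Kw p (CyclotomicField m ℚ) w)‖ := by
  haveI : Fact (w.1.asIdeal.ramificationIdx (𝓞 ℚ) = 1) :=
    ⟨Kw.ramificationIdx_eq_one_of_isCyclotomicExtension m hpm⟩
  exact Kw.exists_padicLog_eq_iff_norm_eulerOperator_le_of_frobeniusLift_of_natCard_eq_one W hp3 hΔ hap ht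
    φ hφp y

/-! ## §4 (appended) Item 20397's tame-level guard `↑w · ↑p = 1` read as `p ∤ m`, `u := w⁻¹ ≡ p` -/

/-- **`↑w · ↑p = 1` in `ZMod m` forces `p ∤ m`** (item 20397 quantifies its compatibility clause over
`w : (ZMod (cycLevel 3 0 r))ˣ` with `↑w * 3 = 1` — so only TAME levels occur): `p` is a unit mod `m`
(Mathlib `ZMod.isUnit_prime_iff_not_dvd`). [folklore] -/
theorem not_dvd_of_coe_mul_natCast_eq_one (w' : (ZMod m)ˣ)
    (hw' : (w' : ZMod m) * ((p : ℕ) : ZMod m) = 1) : ¬ p ∣ m :=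
  (ZMod.isUnit_prime_iff_not_dvd hp.out).mp (IsUnit.of_mul_eq_one_right _ hw')

omit [NeZero m] hp in
/-- `u := w⁻¹` satisfies `↑u = ↑p` when `↑w · ↑p = 1` (so `σ_u` is the Frobenius and `σ_w = σ_u⁻¹`). [folklore] -/
theorem coe_inv_eq_natCast_of_coe_mul_natCast_eq_one (w' : (ZMod m)ˣ)
    (hw' : (w' : ZMod m) * ((p : ℕ) : ZMod m) = 1) : ((w'⁻¹ : (ZMod m)ˣ) : ZMod m) = (p : ZMod m) :=
  Units.inv_eq_of_mul_eq_one_right hw'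

/-- ★★ **The lattice lemma keyed on item 20397's own level binder** `w : (ZMod m)ˣ`, `↑w · ↑p = 1`: with
`φ := (σ_{w⁻¹})_𝔓` (the Frobenius; `(σ_w)_𝔓 = φ⁻¹` is the operator `S` of the Euler twist `P_w`), on a
good-anomalous row (`p ≥ 3`, `p ∤ Δ_min`, `p ∣ a_p − 1`, `#E(ℚ_p)[p] = 1`):
`(∃ P ∈ E(L_𝔓), log_ω P = y) ↔ ‖φφy − a_p·φy + p·y‖ ≤ ‖p‖` — `exists_padicLog_eq_iff_sigma_of_natCard_eq_one`
with `hpm`, `u`, `hu` derived from `hw`. [cite: BlochKato1990, Example 3.11] [cite: SilvermanAEC2009, VII.3.1, IV.6.1, IV.6.4] -/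
theorem exists_padicLog_eq_iff_sigma_inv_of_natCard_eq_one (w' : (ZMod m)ˣ)
    (hw' : (w' : ZMod m) * ((p : ℕ) : ZMod m) = 1)
    (w : ((Rat.HeightOneSpectrum.primesEquiv (R := 𝓞 ℚ)).symm ⟨p, hp.out⟩).Extension
      (𝓞 (CyclotomicField m ℚ)))
    (hp3 : 3 ≤ p) (hΔ : ¬ (p : ℤ) ∣ WeierstrassCurve.minimalDiscriminantInt W)
    (hap : (p : ℤ) ∣ W.frobeniusTrace p - 1)
    (ht : Nat.card {Q : (W.baseChange ℚ_[p]).toAffine.Point // (p : ℕ) • Q = 0} = 1)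
    (φ : Kw p (CyclotomicField m ℚ) w →ₐ[ℚ_[p]] Kw p (CyclotomicField m ℚ) w)
    (hφ : ∀ y, Kw.toCompletion p (CyclotomicField m ℚ) w (φ y) =
      galAdicCompletionMap (sigma m w'⁻¹)
        (sigma_smul_eq_self_of_coe_eq m p (not_dvd_of_coe_mul_natCast_eq_one m p w' hw') w'⁻¹
          (coe_inv_eq_natCast_of_coe_mul_natCast_eq_one m p w' hw') w)
        (Kw.toCompletion p (CyclotomicField m ℚ) w y))
    (y : Kw p (CyclotomicField m ℚ) w) :
    haveI := Literature.NumberTheory.EllipticCurves.EulerLattice.isIntegral_baseChange w.1 W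
    (∃ P : (W.baseChange (w.1.adicCompletion (CyclotomicField m ℚ))).toAffine.Point,
      Literature.NumberTheory.EllipticCurves.FormalGroupChart.padicLogPointFiniteExt
        (NormedField.valuation : Valuation (w.1.adicCompletion (CyclotomicField m ℚ)) ℝ≥0)
        (W.baseChange (w.1.adicCompletion (CyclotomicField m ℚ))) p P =
          Kw.toCompletion p (CyclotomicField m ℚ) w y) ↔
    ‖φ (φ y) - (W.frobeniusTrace p : Kw p (CyclotomicField m ℚ) w) * φ y
        + (p : Kw p (CyclotomicField m ℚ) w) * y‖ ≤ ‖(p : Kw p (CyclotomicField m ℚ) w)‖ :=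
  exists_padicLog_eq_iff_sigma_of_natCard_eq_one m p W (not_dvd_of_coe_mul_natCast_eq_one m p w' hw')
    w'⁻¹ (coe_inv_eq_natCast_of_coe_mul_natCast_eq_one m p w' hw') w hp3 hΔ hap ht φ hφ y

end Summit.BirchSwinnertonDyer.BirchSwinnertonDyer.Theorems.KimAtThreeCyclotomicSigmaFrobenius

end
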